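import Summits.BirchSwinnertonDyer.Rank1Residual.GaloisImage.IdentityComponentUnramifiedTwist
import Literature.NumberTheory.EllipticCurves.PeriodIndexSupportProofs
import HarnessLib

/-!
# THEOREM A at a place of GOOD reduction above `3`: the unramified cubic twist of a rational
# `3`-torsion point is a Kummer class (cell `b2b-bsdres`, team n1011, seat p10 GEN 9;
# ROW T-VIS3-UC-IOTA FILE 4; skeleton `cells/n1011/skel/T-VIS3-UC-IOTA.md`)

HONEST FRAMING (cell `b2b-bsdres`, run/shared/lean/b2b/bsd-rank1-residual/, verbatim in every
file): the goal of the cell is to DELETE the COMBINATION-SHAPED residual classes of the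
Birch–Swinnerton-Dyer formula for ALL analytic-rank `≤ 1` elliptic curves over `ℚ` — "full BSD
formula for every rank `≤ 1` curve in class `C`" assembled STRICTLY from published theorems — so
that the rank-`≤ 1` remainder becomes exactly the CONSTRUCTION-SHAPED classes, which are TYPED
(missing-input `Prop`s), NOT attempted. This is not "finishing BSD". Team n1011 (N10 / N11):
research route on the CONSTRUCTION-SHAPED class X4 (§I N11 LOWER half / O7); no claim beyond the
stated classes; nothing is booked; marks UNCHANGED. Theorems only: no definition, no named fact,
no `sorry`. TOOL theorem; it closes nothing by itself.

## What

`exists_localPoints_twist_of_hasGoodReductionAt` — the GOOD-reduction twin of FILE 8a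
(`IdentityComponentLocalTwist.exists_localPoints_twist_of_identityComponent`): at a place `v ∣ 3`
of GOOD reduction for `E = W` (`−23 = δ²`, `X³ − X − 1` rootless in `K_v`, `α³ = α + 1`,
`F₀ • α ≠ α`), for every `K_v`-rational `3`-torsion point `T` of `E(K̄_v)` there is
`Q₀ ∈ E(K̄_v)` fixed by `Stab(α)` with `F₀ • Q₀ − Q₀ = T` and `3 • Q₀` rational. Proof (L41-NOTE
§1, the case `E₀ = E`): the crossed homomorphism `g(σ) = i(σ) • T` (`σ = F₀^{i(σ)} h`, `h ∈ Stab(α)`;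
the exponent bookkeeping of FILE 7d) is continuous (zero set `Stab(α)`, open) and vanishes on the
inertia group (`smul_cubicRoot_eq_of_mem_inertia`: `K_v(α)/K_v` is unramified), so its class in
`H¹(K_v, E)` is `0` by Milne *ADT* I.3.8 at good reduction — the tree's PROVED
`Milne2006_unramifiedClass_eq_zero_holds` (`PeriodIndexSupportProofs`); a trivialising point is `Q₀`.
Consumer: the add/good and good/good comparison-index bounds `ι_{v₀}(θ) ≤ 3` of FILE 1b's abstract
`relIndex_map_selmerLocalKer_le_three_of_twists` (r1 ROUTE-1 §51.4: the 2 add/good D44-K rows).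
References: [MilneADT2006] I.3.8; [SilvermanAEC2009] VIII.§2; L41-NOTE §1 (`HOME/b2b-bsdres-n1011-p10/g8/`). -/

noncomputable section

open scoped Classical NNReal Topology
open NumberField IsDedekindDomain Field Polynomial

namespace Summit.BirchSwinnertonDyer.Rank1Residual.GaloisImage.TwistedWitness

open WeierstrassCurve Literature.NumberTheory.EllipticCurves Literature.NumberTheory.GaloisRepresentations
  IsDedekindDomain.HeightOneSpectrum

variable {K : Type} [Field K] [NumberField K] (W : WeierstrassCurve K) [W.IsElliptic]
  {v : HeightOneSpectrum (𝓞 K)}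

/-- **THEOREM A at GOOD reduction, in `E(K̄_v)`.** `v ∣ 3` a place of good reduction for `W`;
`α³ = α + 1`, `δ² = −23`, `X³ − X − 1` rootless in `K_v`; `F₀ • α ≠ α`; `T ∈ E(K̄_v)` a `K_v`-rational
point with `3 • T = 0`. Then some `Q₀ ∈ E(K̄_v)` is fixed by `Stab(α)`, has `F₀ • Q₀ − Q₀ = T`, and
`3 • Q₀` is fixed by `Γ_{K_v}`. (The unramified class `σ ↦ i(σ) • T` dies in `H¹(K_v, E)` at good
reduction: Milne *ADT* I.3.8, tree `Milne2006_unramifiedClass_eq_zero_holds`.)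
[cite: MilneADT2006, Ch. I Prop. 3.8] [cite: SilvermanAEC2009, VIII.§2] -/
theorem exists_localPoints_twist_of_hasGoodReductionAt (hgood : W.HasGoodReductionAt v)
    (h3v : ((3 : ℕ) : 𝓞 K) ∈ v.asIdeal)
    {α : AlgebraicClosure (v.adicCompletion K)} (hα : α ^ 3 = α + 1)
    {δ : v.adicCompletion K} (hδ : δ ^ 2 = -23)
    (hnoroot : ∀ x : v.adicCompletion K, x ^ 3 - x - 1 ≠ 0)
    (F₀ : absoluteGaloisGroup (v.adicCompletion K)) (hF₀ : F₀ • α ≠ α)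
    (T : localPoints W (v.adicCompletion K)) (hT3 : (3 : ℤ) • T = 0)
    (hTfix : ∀ σ : absoluteGaloisGroup (v.adicCompletion K), σ • T = T) :
    ∃ Q₀ : localPoints W (v.adicCompletion K),
      (∀ h : absoluteGaloisGroup (v.adicCompletion K), h • α = α → h • Q₀ = Q₀) ∧
      F₀ • Q₀ - Q₀ = T ∧
      (∀ σ : absoluteGaloisGroup (v.adicCompletion K), σ • ((3 : ℤ) • Q₀) = (3 : ℤ) • Q₀) := by
  haveI : Fact (Nat.Prime 3) := ⟨Nat.prime_three⟩
  haveI : CharZero (v.adicCompletion K) := charZero_adicCompletion v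
  obtain ⟨w, hw⟩ := v.exists_spectralValuation
  obtain ⟨𝔐, h𝔐⟩ := v.localPrimesAbove_nonempty
  -- the group `H = Stab(α)`, normal of index `3`, and the exponent function (as in FILE 7d)
  set H : Subgroup (absoluteGaloisGroup (v.adicCompletion K)) :=
    MulAction.stabilizer (absoluteGaloisGroup (v.adicCompletion K)) α with hHdef
  haveI hHn : H.Normal := normal_stabilizer_cubicRoot hα hδ
  have hHi : H.index = 3 := index_stabilizer_cubicRoot hα hδ hnoroot
  have hmemH : ∀ σ : absoluteGaloisGroup (v.adicCompletion K), σ ∈ H ↔ σ • α = α := fun σ ↦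
    MulAction.mem_stabilizer_iff
  have hF₀H : F₀ ∉ H := fun h ↦ hF₀ ((hmemH F₀).mp h)
  have hF3 : F₀ ^ 3 ∈ H := by rw [← hHi]; exact Subgroup.pow_index_mem H F₀
  have hzpow : ∀ z : ℤ, F₀ ^ z ∈ H → (3 : ℤ) ∣ z := by
    intro z hz
    have hz3 : 3 * (z / 3) + z % 3 = z := by omega
    have hq : F₀ ^ z = (F₀ ^ (3 : ℕ)) ^ (z / 3) * F₀ ^ (z % 3) := by
      conv_rhs => rw [← zpow_natCast, ← zpow_mul, ← zpow_add, Nat.cast_ofNat, hz3]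
    have hr : F₀ ^ (z % 3) ∈ H := by
      have h1 : (F₀ ^ (3 : ℕ)) ^ (z / 3) ∈ H := H.zpow_mem hF3 _
      have := H.mul_mem (H.inv_mem h1) hz
      rwa [hq, ← mul_assoc, inv_mul_cancel, one_mul] at this
    rcases (show z % 3 = 0 ∨ z % 3 = 1 ∨ z % 3 = 2 by omega) with h0 | h1 | h2
    · exact Int.dvd_of_emod_eq_zero h0
    · exfalso; rw [h1, zpow_one] at hr; exact hF₀H hr
    · exfalso
      rw [h2] at hr
      have : F₀ = F₀ ^ (3 : ℕ) * (F₀ ^ (2 : ℤ))⁻¹ := by group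
      exact hF₀H (this ▸ H.mul_mem hF3 (H.inv_mem hr))
  have hgen := exists_pow_mul_of_index_eq_prime H hHi hF₀H
  choose i hσ hhσ heq using hgen
  have hiadd : ∀ σ τ : absoluteGaloisGroup (v.adicCompletion K),
      (3 : ℤ) ∣ ((i (σ * τ) : ℤ) - (i σ + i τ)) := by
    intro σ τ
    apply hzpow
    have eσ := heq σ
    have eτ := heq τ
    have est := heq (σ * τ)
    have hs := hhσ σ
    have ht := hhσ τ
    have hst := hhσ (σ * τ)
    generalize i σ = a, i τ = b, i (σ * τ) = c, hσ σ = s, hσ τ = t, hσ (σ * τ) = u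
      at eσ eτ est hs ht hst ⊢
    rw [eσ, eτ] at est
    have hc : F₀ ^ (c : ℤ) = F₀ ^ (a : ℤ) * s * (F₀ ^ (b : ℤ) * t) * u⁻¹ := by
      rw [eq_mul_inv_iff_mul_eq, zpow_natCast, zpow_natCast, zpow_natCast]; exact est.symm
    have key : F₀ ^ ((c : ℤ) - (a + b)) =
        F₀ ^ (a : ℤ) * (s * (F₀ ^ (b : ℤ) * (t * u⁻¹) * (F₀ ^ (b : ℤ))⁻¹)) * (F₀ ^ (a : ℤ))⁻¹ := by
      rw [zpow_sub, hc]; group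
    rw [key]
    refine hHn.conj_mem _ ?_ _
    exact H.mul_mem hs (hHn.conj_mem _ (H.mul_mem ht (H.inv_mem hst)) _)
  have hiH : ∀ σ : absoluteGaloisGroup (v.adicCompletion K), σ ∈ H → (3 : ℤ) ∣ (i σ : ℤ) := by
    intro σ hσH
    apply hzpow
    have e : F₀ ^ (i σ) = σ * (hσ σ)⁻¹ := by rw [eq_mul_inv_iff_mul_eq]; exact (heq σ).symm
    rw [zpow_natCast, e]
    exact H.mul_mem hσH (H.inv_mem (hhσ σ))
  have hiF₀ : (3 : ℤ) ∣ ((i F₀ : ℤ) - 1) := by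
    apply hzpow
    have e : F₀ ^ (i F₀) = F₀ * (hσ F₀)⁻¹ := by rw [eq_mul_inv_iff_mul_eq]; exact (heq F₀).symm
    rw [zpow_sub, zpow_one, zpow_natCast, e]
    exact hHn.conj_mem _ (H.inv_mem (hhσ F₀)) F₀
  -- `H` is open
  have hαint : IsIntegral (v.adicCompletion K) α := by
    refine ⟨X ^ 3 - X - 1, by monicity!, ?_⟩
    simp only [eval₂_sub, eval₂_X_pow, eval₂_X, eval₂_one]
    rw [hα]; ring
  have hHopen : IsOpen (H : Set (absoluteGaloisGroup (v.adicCompletion K))) := by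
    apply Subgroup.isOpen_of_mem_nhds H (g := 1)
    haveI := IntermediateField.adjoin.finiteDimensional hαint
    refine (krullTopology_mem_nhds_one_iff (v.adicCompletion K) (AlgebraicClosure (v.adicCompletion K)) _).mpr
      ⟨IntermediateField.adjoin (v.adicCompletion K) {α}, inferInstance, fun σ hσ ↦ ?_⟩
    exact (hmemH σ).mpr ((IntermediateField.mem_fixingSubgroup_iff _ _).mp hσ α
      (IntermediateField.mem_adjoin_simple_self (v.adicCompletion K) α))
  -- multiples of `T`
  have hzsmul3 : ∀ m n : ℤ, (3 : ℤ) ∣ (m - n) → m • T = n • T := by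
    rintro m n ⟨k, hk⟩
    have e : m = n + k * 3 := by linarith
    rw [e, add_zsmul, mul_zsmul, hT3, zsmul_zero, add_zero]
  -- the crossed homomorphism `g σ = i σ • T`
  set g : absoluteGaloisGroup (v.adicCompletion K) → localPoints W (v.adicCompletion K) :=
    fun σ ↦ (i σ : ℤ) • T with hgdef
  have hg : ∀ σ τ, g (σ * τ) = g σ + σ • g τ := by
    intro σ τ
    simp only [hgdef]
    rw [W.smul_zsmul_localPoints (i τ : ℤ) σ T, hTfix, ← add_zsmul]
    exact hzsmul3 _ _ (hiadd σ τ)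
  have hgH : ∀ σ, σ ∈ H → g σ = 0 := fun σ hσH ↦ by
    simp only [hgdef]; rw [hzsmul3 _ 0 (by simpa using hiH σ hσH), zero_zsmul]
  -- continuity: `g` is constant on the open cosets `σH`
  have hcont : Continuous g := by
    refine (IsLocallyConstant.iff_exists_open g).mpr (fun σ ↦ ?_) |>.continuous
    refine ⟨(fun τ ↦ σ * τ) '' (H : Set (absoluteGaloisGroup (v.adicCompletion K))),
      (Homeomorph.mulLeft σ).isOpenMap _ hHopen, ⟨1, H.one_mem, mul_one σ⟩, ?_⟩
    rintro _ ⟨h, hh, rfl⟩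
    rw [hg, hgH h hh, smul_zero, add_zero]
  let f : contOneCocycles (discreteTopRep (absoluteGaloisGroup (v.adicCompletion K))
      (localPoints W (v.adicCompletion K))) :=
    ⟨⟨g, hcont⟩, fun σ τ ↦ by rw [discreteTopRep_ρ_apply]; exact hg σ τ⟩
  have hf : ∀ σ, f.1 σ = g σ := fun σ ↦ rfl
  -- `g` vanishes on the inertia group (`K_v(α)/K_v` is unramified)
  have hI : ∀ τ ∈ 𝔐.inertia (absoluteGaloisGroup (v.adicCompletion K)), f.1 τ = 0 := fun τ hτ ↦
    hgH τ ((hmemH τ).mpr (smul_cubicRoot_eq_of_mem_inertia hw h3v h𝔐 hα hδ hτ))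
  -- Milne I.3.8 at good reduction: the class of `f` is `0`
  have h0 := Milne2006_unramifiedClass_eq_zero_holds W v hgood h𝔐 f hI
  obtain ⟨Q₀, hQ₀⟩ := (oneCocycleClass_eq_zero_iff _ f).mp h0
  have hQ₀' : ∀ σ : absoluteGaloisGroup (v.adicCompletion K), g σ = σ • Q₀ - Q₀ := fun σ ↦ by
    rw [← hf, hQ₀ σ, discreteTopRep_ρ_apply]
  refine ⟨Q₀, fun h hh ↦ ?_, ?_, fun σ ↦ ?_⟩
  · have := hQ₀' h
    rw [hgH h ((hmemH h).mpr hh), eq_comm, sub_eq_zero] at this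
    exact this
  · rw [← hQ₀' F₀]
    simp only [hgdef]
    rw [hzsmul3 _ 1 hiF₀, one_zsmul]
  · have e : σ • ((3 : ℤ) • Q₀) - (3 : ℤ) • Q₀ = (3 : ℤ) • g σ := by
      rw [hQ₀' σ, zsmul_sub, W.smul_zsmul_localPoints]
    rw [← sub_eq_zero, e]
    simp only [hgdef]
    rw [smul_smul, mul_comm, ← smul_smul, hT3, zsmul_zero]

end Summit.BirchSwinnertonDyer.Rank1Residual.GaloisImage.TwistedWitness

end
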